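import Literature.MathematicalPhysics.QuantumLattice.PairSourcedTorusTrialStateLimit
import Literature.MathematicalPhysics.QuantumLattice.TorusLimitOfMixtures
import Literature.MathematicalPhysics.QuantumLattice.TorusSectorGibbsMixture
import Literature.MathematicalPhysics.QuantumLattice.GibbsSectorWeightTransfer
import Literature.MathematicalPhysics.QuantumLattice.GibbsTwoTimeBound
import HarnessLib

/-!
# GIBBS (density-matrix) trial states of the pair-sourced `t–t'` Hubbard tori: their thermodynamic
# limits are translation-invariant states carrying the limiting density and sourced mean energy
# (the «tiled-trial-state TI bridge» in MIXTURE form, with INTERVAL rows)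

Topic `Literature/MathematicalPhysics/QuantumLattice`; namespace `Literature.MathematicalPhysics.QuantumLattice`
(the file path). Companion of `PairSourcedTorusTrialStateLimit.lean` (steps (i)–(iii) of the bridge for PURE
torus trial vectors with EXACT rows) and of `TorusLimitOfMixtures(Compactness).lean` (the mixture form
`InfVolFermionState.IsTorusLimitOfMixture ω m p ψ Ls` of the torus-limit predicate: weighted translation
averages of finitely many torus vectors, e.g. a Gibbs density matrix with periodic boundary conditions,
Israel 1979 §I.3 eq. (26)). A quasi-free (Hartree–Fock–BCS) trial state of the pinned torus is the GIBBS
STATE `ρ_L = e^{−βB_L}/Z` of a Hermitian trial matrix `B_L` (Bach–Lieb–Solovej 1994 §2): a density matrix,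
i.e. a MIXTURE of the eigenvectors of `B_L` with the Boltzmann weights, whose rows — the number per site
`Re tr(ρ_L N)/L²` and the sourced energy per site `Re tr(ρ_L A_L(h))/L²`, `A_L(h) = dWaveSourceTorusTT' L tp U μ h`
— are certified only up to INTERVALS and only depend on `L` through vanishing slacks `c/L`
(two-grid Riemann-sum controls). This file supplies the corresponding bridge:

* §1 `sum_canonicalWeight_mul_expect_eigenvectorUnitary_eq_gibbsState` — for every Hermitian `A` and every
  matrix `B`: `Σ_a w_a ⟨u_a, B u_a⟩ = gibbsState β A B` with `u_a` the columns of Mathlib's eigenvector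
  unitary of `A` and `w_a = e^{−βE_a}/Σ_b e^{−βE_b}` (`canonicalWeight`): the Gibbs state IS the
  eigen-mixture, on every observable (full-space twin of
  `sum_canonicalWeight_mul_expect_sectorEigenvector_eq_gibbsState`); the columns are unit vectors.
* §2 for MIXTURE torus limits (`IsTorusLimitOfMixture`, any weights): the weighted numbers per site converge
  to the density (`…tendsto_sum_mul_re_expect_totalNumber`, any `d`) and the weighted sourced energies per
  site converge to the sourced mean energy `e^{src}_{h}(ω) = ω.meanEnergy (hubbardTTPrimeSourcedInteraction 1 tp U μ
  dWaveFormFactor h) 1` (`…tendsto_sum_mul_re_expect_dWaveSourceTorusTT'`; the per-vector identity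
  `re_expect_dWaveSourceTorusTT'_div_sq_eq` behind the pure version `IsTorusLimitOf.tendsto_re_expect_dWaveSourceTorusTT'`);
  hence INTERVAL rows with vanishing slack pass to the limit: `a − c/L ≤ n_L ≤ b + c/L` eventually gives
  `a ≤ ω.density ≤ b` (`…density_mem_Icc_of_eventually`), and an energy cap that is an affine-plus-convex-quadratic
  function of the number per site, `e_L ≤ C + μ'·n_L + U'·n_L²/4 + c/L` (the shape of a Hartree term), gives
  `e^{src}_h(ω) ≤ C + μ'·ω.density + U'·ω.density²/4` (`…meanEnergy_sourced_le_quad_density_of_eventually`).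
* The EXISTENCE step (compactness of the eigen-mixtures; two families bracketing a density `n` mixed to density
  EXACTLY `n` under four corner conditions) is the companion file `PairSourcedTorusGibbsTrialStateMixing.lean`;
  together they discharge the hypothesis `hcap` of `Summits/…/Observables/TISourcedMinimiserChordFloorExact.lean`
  (`re_expect_localPairAt_ge_of_minimiser`: the canonical TI-density-`n` class of the pinning-field chord floor)
  from quasi-free (or any Gibbs-type) torus trial states with certified interval rows.

Everything is PROVED from the tree; no definition, no named fact, zero compute. HONEST SCOPE: a variational
CAP on a sourced mean energy in infinite volume from finite trial data; by itself it floors nothing; the chord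
floors it feeds are finite-field RESPONSE floors, not order parameters.

## Mathlib / tree search

REUSED: `InfVolFermionState.IsTorusLimitOfMixture`, `torusAvgExpect_nAt_add_nAt_eq`,
`torusAvgExpect_hubbardTTPrime_meanEnergyObs`, `torusAvgExpect_nAt`, `torusAvgExpect_localPairAt_zero`,
`InfVolFermionState.meanEnergy_hubbardTTPrimeSourced`, `InfVolFermionState.meanEnergy_pairSourceInteraction_dWave_eq`,
`canonicalWeight(_nonneg)`, `sum_canonicalWeight`, `partitionFn_eq_sum_exp`, `trace_gibbsWeight_mul_eq_sum`,
`star_mul_mul_apply_self_eq_star_dotProduct_mulVec`.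
`lean search 'IsTorusLimitOfMixture.*density|IsTorusLimitOfMixture.*[Ss]ourced|gibbs.*IsTorusLimitOfMixture'`:
only the canonical-sector Gibbs data of `TorusSectorGibbsMixture` (`…density_eq_of_sectorGibbs`, number
eigenvectors) — no sourced-energy or interval-density rows for general mixtures.

## References

* O. Bratteli, D. W. Robinson, *Operator Algebras and Quantum Statistical Mechanics 1* (1987), §4.3.1
  (invariant states as group averages; weak-⋆ limit points) and Thm. 2.3.15 (weak-⋆ compactness).
  [cite: BratteliRobinsonI1987, §4.3.1]
* R. B. Israel, *Convexity in the Theory of Lattice Gases* (1979), §I.3 eq. (26) (periodic-boundary-condition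
  Gibbs states) and Lemma II.3.1. [cite: Israel1979, §I.3 eq. (26)]
* D. Ruelle, *Statistical Mechanics* (1969), §3.4 (trial states and the mean energy per site). [cite: Ruelle1969, §3.4]
* V. Bach, E. H. Lieb, J. P. Solovej, J. Stat. Phys. 76 (1994) 3–89, §2 (quasi-free / generalized Hartree–Fock
  states as Gibbs states of quadratic Hamiltonians). [cite: BachLiebSolovej1994, §2]
* T. Koma, H. Tasaki, J. Stat. Phys. 76 (1994) 745–803, §1 (symmetry-breaking source `H − hO`).
  [cite: KomaTasaki1994, §1]
-/

noncomputable section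

namespace Literature.MathematicalPhysics.QuantumLattice

open Matrix Finset HubbardWave0 _root_.Filter Literature.Probability.LatticeModels ThermodynamicLimit
open scoped _root_.Topology ComplexOrder BigOperators

/-! ### §1 The Gibbs state of a Hermitian matrix is the eigen-mixture, on every observable -/

section EigenMixture

variable {ι : Type*} [Fintype ι] [DecidableEq ι]

/-- **The columns of the eigenvector unitary are unit vectors**: `⟨u_a, u_a⟩ = 1` (orthonormal eigenbasis of a
Hermitian matrix). [cite: Tasaki2020, §2.2] -/
theorem star_eigenvectorUnitary_col_dotProduct_self {A : Matrix ι ι ℂ} (hA : A.IsHermitian) (a : ι) :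
    star (fun i => (hA.eigenvectorUnitary : Matrix ι ι ℂ) i a) ⬝ᵥ
        (fun i => (hA.eigenvectorUnitary : Matrix ι ι ℂ) i a) = 1 := by
  have hUU : star (hA.eigenvectorUnitary : Matrix ι ι ℂ) * (hA.eigenvectorUnitary : Matrix ι ι ℂ) = 1 :=
    Matrix.mem_unitaryGroup_iff'.1 hA.eigenvectorUnitary.2
  have h := star_mul_mul_apply_self_eq_star_dotProduct_mulVec (hA.eigenvectorUnitary : Matrix ι ι ℂ) 1 a
  rw [Matrix.mul_one, hUU, Matrix.one_apply_eq, Matrix.one_mulVec] at h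
  exact h.symm

/-- **The Gibbs state IS the eigen-mixture, on every observable.** For a Hermitian `A`, the columns `u_a` of
its eigenvector unitary and the Boltzmann weights `w_a = e^{−βE_a}/Σ_b e^{−βE_b}` (`canonicalWeight`):
`Σ_a w_a ⟨u_a, B u_a⟩ = gibbsState β A B = tr(e^{−βA}B)/tr(e^{−βA})` for EVERY matrix `B`.
[cite: Israel1979, §I.3 eq. (26)] -/
theorem sum_canonicalWeight_mul_expect_eigenvectorUnitary_eq_gibbsState (A : Matrix ι ι ℂ)
    (hA : A.IsHermitian) (β : ℝ) (B : Matrix ι ι ℂ) :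
    ∑ a, (canonicalWeight β hA.eigenvalues a : ℂ) *
        (star (fun i => (hA.eigenvectorUnitary : Matrix ι ι ℂ) i a) ⬝ᵥ
          (B *ᵥ fun i => (hA.eigenvectorUnitary : Matrix ι ι ℂ) i a)) = gibbsState β A B := by
  have hq : ∀ a, star (fun i => (hA.eigenvectorUnitary : Matrix ι ι ℂ) i a) ⬝ᵥ
      (B *ᵥ fun i => (hA.eigenvectorUnitary : Matrix ι ι ℂ) i a) =
      ((star hA.eigenvectorUnitary : Matrix ι ι ℂ) * B * (hA.eigenvectorUnitary : Matrix ι ι ℂ)) a a := by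
    intro a
    rw [star_mul_mul_apply_self_eq_star_dotProduct_mulVec]
  simp_rw [hq, canonicalWeight]
  rw [gibbsState_apply, partitionFn_eq_sum_exp β hA, trace_gibbsWeight_mul_eq_sum hA β B, Finset.mul_sum]
  refine Finset.sum_congr rfl fun a _ => ?_
  push_cast
  simp only [neg_mul]
  ring

/-- Real form of the eigen-mixture identity: `Σ_a w_a Re⟨u_a, B u_a⟩ = Re gibbsState β A B`. [cite: Israel1979, §I.3 eq. (26)] -/
theorem sum_canonicalWeight_mul_re_expect_eigenvectorUnitary_eq (A : Matrix ι ι ℂ)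
    (hA : A.IsHermitian) (β : ℝ) (B : Matrix ι ι ℂ) :
    ∑ a, canonicalWeight β hA.eigenvalues a *
        (star (fun i => (hA.eigenvectorUnitary : Matrix ι ι ℂ) i a) ⬝ᵥ
          (B *ᵥ fun i => (hA.eigenvectorUnitary : Matrix ι ι ℂ) i a)).re = (gibbsState β A B).re := by
  rw [← sum_canonicalWeight_mul_expect_eigenvectorUnitary_eq_gibbsState A hA β B, Complex.re_sum]
  refine Finset.sum_congr rfl fun a _ => ?_
  rw [Complex.re_ofReal_mul]

end EigenMixture

/-! ### §2 Rows of mixture torus limits: the density and the sourced mean energy -/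

section MixtureRows

variable {d : ℕ}

/-- Real parts of weighted sums with real weights. [folklore] -/
private theorem re_sum_ofReal_mul {κ : Type*} (s : Finset κ) (p : κ → ℝ) (z : κ → ℂ) :
    (∑ i ∈ s, (p i : ℂ) * z i).re = ∑ i ∈ s, p i * (z i).re := by
  rw [Complex.re_sum]
  exact Finset.sum_congr rfl fun i _ => Complex.re_ofReal_mul _ _

variable {ω : InfVolFermionState d} {m : ℕ → ℕ} {p : ∀ L, Fin (m L) → ℝ}
  {ψ : ∀ L, Fin (m L) → Fock (Orb (FermionTorus d L))} {Ls : ℕ → ℕ}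

/-- **Weighted local expectations of a mixture torus limit converge (real parts).** For every region `Λ` and
local `A`: `Σ_i p_{j,i} Re avg_{L_j}(A)(ψ_{j,i}) → Re ω_Λ(A)`. [cite: BratteliRobinsonI1987, §4.3.1] -/
theorem InfVolFermionState.IsTorusLimitOfMixture.tendsto_sum_mul_re_torusAvgExpect
    (hω : ω.IsTorusLimitOfMixture m p ψ Ls) (Λ : Finset (Site d)) (A : FermionOp Λ) :
    Tendsto (fun j => ∑ i, p (Ls j) i * (torusAvgExpect (Ls j) Λ A (ψ (Ls j) i)).re) atTop
      (𝓝 (ω.expect Λ A).re) := by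
  refine ((Complex.continuous_re.tendsto _).comp (hω Λ A)).congr fun j => ?_
  rw [Function.comp_apply, re_sum_ofReal_mul]

/-- **The weighted numbers per site of a mixture torus limit converge to its density**:
`Σ_i p_{j,i} Re⟨ψ_{j,i}, N ψ_{j,i}⟩/L_j^d → ω.density` (`L_j ≠ 0`; every component obeys
`avg(n_{0↑}) + avg(n_{0↓}) = ⟨ψ, Nψ⟩/L^d`, `torusAvgExpect_nAt_add_nAt_eq`; no particle-number hypothesis).
[cite: Ruelle1969, §3.4] -/
theorem InfVolFermionState.IsTorusLimitOfMixture.tendsto_sum_mul_re_expect_totalNumber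
    [hL0 : ∀ j, NeZero (Ls j)] (hω : ω.IsTorusLimitOfMixture m p ψ Ls) :
    Tendsto (fun j => ∑ i, p (Ls j) i * ((QuantumLattice.expect totalNumber (ψ (Ls j) i)).re / (Ls j : ℝ) ^ d))
      atTop (𝓝 ω.density) := by
  have hN0 := hω.tendsto_sum_mul_re_torusAvgExpect ({0} : Finset (Site d)) (nAt 0 (Finset.mem_singleton_self 0) 0)
  have hN1 := hω.tendsto_sum_mul_re_torusAvgExpect ({0} : Finset (Site d)) (nAt 0 (Finset.mem_singleton_self 0) 1)
  have heq : ∀ j, ∑ i, p (Ls j) i * ((QuantumLattice.expect totalNumber (ψ (Ls j) i)).re / (Ls j : ℝ) ^ d) =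
      ∑ i, p (Ls j) i * (torusAvgExpect (Ls j) ({0} : Finset (Site d)) (nAt 0 (Finset.mem_singleton_self 0) 0)
          (ψ (Ls j) i)).re +
        ∑ i, p (Ls j) i * (torusAvgExpect (Ls j) ({0} : Finset (Site d)) (nAt 0 (Finset.mem_singleton_self 0) 1)
          (ψ (Ls j) i)).re := by
    intro j
    rw [← Finset.sum_add_distrib]
    refine Finset.sum_congr rfl fun i _ => ?_
    have hLc : ((Ls j : ℂ)) ^ d = (((Ls j : ℝ) ^ d : ℝ) : ℂ) := by push_cast; rfl
    rw [← mul_add, ← Complex.add_re, torusAvgExpect_nAt_add_nAt_eq, hLc, Complex.div_ofReal_re]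
  have hval : ω.density = (ω.expect {0} (nAt 0 (Finset.mem_singleton_self 0) 0)).re +
      (ω.expect {0} (nAt 0 (Finset.mem_singleton_self 0) 1)).re := by
    rw [InfVolFermionState.density, InfVolFermionState.densityAt, map_add, Complex.add_re]
  rw [hval]
  exact (hN0.add hN1).congr fun j => (heq j).symm

/-- `b + c/L_j → b` along `L_j → ∞`. [folklore] -/
private theorem tendsto_const_add_div_natCast {Ls : ℕ → ℕ} (hLs : Tendsto Ls atTop atTop) (b c : ℝ) :
    Tendsto (fun j => b + c / (Ls j : ℝ)) atTop (𝓝 b) := by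
  have h : Tendsto (fun j => c / (Ls j : ℝ)) atTop (𝓝 0) :=
    tendsto_const_nhds.div_atTop (tendsto_natCast_atTop_atTop.comp hLs)
  simpa using (tendsto_const_nhds (x := b)).add h

/-- **Interval density rows with vanishing slack pass to the limit**: if eventually
`a − c/L_j ≤ Σ_i p_{j,i} Re⟨ψ_{j,i}, Nψ_{j,i}⟩/L_j^d ≤ b + c/L_j`, then `a ≤ ω.density ≤ b`.
[cite: Ruelle1969, §3.4] -/
theorem InfVolFermionState.IsTorusLimitOfMixture.density_mem_Icc_of_eventually [hL0 : ∀ j, NeZero (Ls j)]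
    (hω : ω.IsTorusLimitOfMixture m p ψ Ls) (hLs : Tendsto Ls atTop atTop) {a b c : ℝ}
    (ha : ∀ᶠ j in atTop, a - c / (Ls j : ℝ) ≤
      ∑ i, p (Ls j) i * ((QuantumLattice.expect totalNumber (ψ (Ls j) i)).re / (Ls j : ℝ) ^ d))
    (hb : ∀ᶠ j in atTop, ∑ i, p (Ls j) i * ((QuantumLattice.expect totalNumber (ψ (Ls j) i)).re / (Ls j : ℝ) ^ d) ≤
      b + c / (Ls j : ℝ)) :
    a ≤ ω.density ∧ ω.density ≤ b := by
  have hlim := hω.tendsto_sum_mul_re_expect_totalNumber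
  refine ⟨?_, ?_⟩
  · have hl : Tendsto (fun j => a + (-c) / (Ls j : ℝ)) atTop (𝓝 a) := tendsto_const_add_div_natCast hLs a (-c)
    refine le_of_tendsto_of_tendsto hl hlim (ha.mono fun j hj => ?_)
    have : a + (-c) / (Ls j : ℝ) = a - c / (Ls j : ℝ) := by rw [neg_div, ← sub_eq_add_neg]
    simp only [this]
    exact hj
  · exact le_of_tendsto_of_tendsto hlim (tendsto_const_add_div_natCast hLs b c) hb

end MixtureRows

section SourcedEnergy

variable {ω : InfVolFermionState 2} {m : ℕ → ℕ} {p : ∀ L, Fin (m L) → ℝ}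
  {ψ : ∀ L, Fin (m L) → Fock (Orb (FermionTorus 2 L))} {Ls : ℕ → ℕ}

/-- `⟨ψ, Aᴴ ψ⟩ = conj ⟨ψ, A ψ⟩`. [folklore] -/
private theorem star_dotProduct_conjTranspose_mulVec_eq_star' {κ : Type*} [Fintype κ] (A : Matrix κ κ ℂ) (v : κ → ℂ) :
    star v ⬝ᵥ (Aᴴ *ᵥ v) = star (star v ⬝ᵥ (A *ᵥ v)) := by
  rw [star_dotProduct, star_mulVec, conjTranspose_conjTranspose, ← dotProduct_mulVec]

/-- **The sourced energy per site of ANY torus vector in terms of translation averages** (`L ≥ 3`):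
`Re⟨ψ, A_L(h') ψ⟩/L² = Re avg(E^{tt'}_Φ)(ψ) − μ·(Re avg(n_{0↑})(ψ) + Re avg(n_{0↓})(ψ)) − h'·2 Re avg(P₀)(ψ)`,
`A_L(h') = dWaveSourceTorusTT' L tp U μ h'` (the translates of `E_Φ`, `n_{0σ}`, `P₀` exhaust `H_L`, `N_σ`, `Δ_d`;
the identity inside `IsTorusLimitOf.tendsto_re_expect_dWaveSourceTorusTT'`, stated for reuse by mixtures).
[cite: BratteliRobinsonI1987, §4.3.1] -/
theorem re_expect_dWaveSourceTorusTT'_div_sq_eq (L : ℕ) [NeZero L] (hL : 3 ≤ L) (tp U μ h' : ℝ)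
    (φ : Fock (Orb (FermionTorus 2 L))) :
    (QuantumLattice.expect (dWaveSourceTorusTT' L tp U μ h') φ).re / (L : ℝ) ^ 2 =
      (torusAvgExpect L (thicken ({0} : Finset (Site 2)) 1)
          ((hubbardTTPrimeFermionInteraction 1 tp U).meanEnergyObs 1) φ).re -
        μ * ((torusAvgExpect L ({0} : Finset (Site 2)) (nAt 0 (Finset.mem_singleton_self 0) 0) φ).re +
          (torusAvgExpect L ({0} : Finset (Site 2)) (nAt 0 (Finset.mem_singleton_self 0) 1) φ).re) -
        h' * (2 * (torusAvgExpect L (pairRegion (insert (0 : Site 2) unitSteps) 0)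
          (localPairAt (insert 0 unitSteps) dWaveFormFactor 0) φ).re) := by
  rw [torusAvgExpect_hubbardTTPrime_meanEnergyObs 1 tp U hL, torusAvgExpect_nAt, torusAvgExpect_nAt,
    torusAvgExpect_localPairAt_zero L dWaveFormFactor hL]
  have hN : (totalNumber : Matrix (Finset (Orb (FermionTorus 2 L))) (Finset (Orb (FermionTorus 2 L))) ℂ) =
      (∑ y : FermionTorus 2 L, numberOp y 0) + ∑ y : FermionTorus 2 L, numberOp y 1 := by
    rw [totalNumber, ← Finset.sum_add_distrib]
    exact Finset.sum_congr rfl fun y _ => Fin.sum_univ_two _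
  have hexp : QuantumLattice.expect (dWaveSourceTorusTT' L tp U μ h') φ =
      QuantumLattice.expect (hubbardTorusTT' L 1 tp U) φ -
        (μ : ℂ) * (QuantumLattice.expect (∑ y : FermionTorus 2 L, numberOp y 0) φ +
          QuantumLattice.expect (∑ y : FermionTorus 2 L, numberOp y 1) φ) -
        (h' : ℂ) * (QuantumLattice.expect (pairField dWaveFormFactor L) φ +
          star (QuantumLattice.expect (pairField dWaveFormFactor L) φ)) := by
    unfold dWaveSourceTorusTT'
    rw [hN]
    simp only [QuantumLattice.expect, Matrix.sub_mulVec, Matrix.add_mulVec, Matrix.smul_mulVec, dotProduct_sub,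
      dotProduct_add, dotProduct_smul, smul_eq_mul]
    rw [star_dotProduct_conjTranspose_mulVec_eq_star']
  rw [hexp]
  have hL0 : ((L : ℝ)) ^ 2 ≠ 0 := by positivity
  have hLc : ((L : ℂ)) ^ 2 = (((L : ℝ) ^ 2 : ℝ) : ℂ) := by push_cast; ring
  simp only [hLc, Complex.div_ofReal_re, Complex.sub_re, Complex.add_re, Complex.mul_re, Complex.ofReal_re,
    Complex.ofReal_im, zero_mul, sub_zero, Complex.star_def, Complex.conj_re]
  field_simp
  ring

/-- **The weighted sourced energies per site of a mixture torus limit converge to its sourced mean energy**,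
simultaneously for all sources: along `L_j → ∞`,
`Σ_i p_{j,i} Re⟨ψ_{j,i}, A_{L_j}(h') ψ_{j,i}⟩/L_j² → e^{src}_{h'}(ω) = ω.meanEnergy (hubbardTTPrimeSourcedInteraction 1 tp U μ dWaveFormFactor h') 1`
(any real weights). [cite: BratteliRobinsonI1987, §4.3.1] -/
theorem InfVolFermionState.IsTorusLimitOfMixture.tendsto_sum_mul_re_expect_dWaveSourceTorusTT'
    [hL0 : ∀ j, NeZero (Ls j)] (hω : ω.IsTorusLimitOfMixture m p ψ Ls) (hLs : Tendsto Ls atTop atTop)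
    (tp U μ h' : ℝ) :
    Tendsto (fun j => ∑ i, p (Ls j) i *
        ((QuantumLattice.expect (dWaveSourceTorusTT' (Ls j) tp U μ h') (ψ (Ls j) i)).re / (Ls j : ℝ) ^ 2))
      atTop (𝓝 (ω.meanEnergy (hubbardTTPrimeSourcedInteraction 1 tp U μ dWaveFormFactor h') 1)) := by
  -- the four limits of weighted translation averages
  have hE := hω.tendsto_sum_mul_re_torusAvgExpect (thicken ({0} : Finset (Site 2)) 1)
    ((hubbardTTPrimeFermionInteraction 1 tp U).meanEnergyObs 1)
  have hN0 := hω.tendsto_sum_mul_re_torusAvgExpect ({0} : Finset (Site 2)) (nAt 0 (Finset.mem_singleton_self 0) 0)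
  have hN1 := hω.tendsto_sum_mul_re_torusAvgExpect ({0} : Finset (Site 2)) (nAt 0 (Finset.mem_singleton_self 0) 1)
  have hP := hω.tendsto_sum_mul_re_torusAvgExpect (pairRegion (insert (0 : Site 2) unitSteps) 0)
    (localPairAt (insert 0 unitSteps) dWaveFormFactor 0)
  -- the target, rewritten
  have htarget : ω.meanEnergy (hubbardTTPrimeSourcedInteraction 1 tp U μ dWaveFormFactor h') 1 =
      (ω.expect _ ((hubbardTTPrimeFermionInteraction 1 tp U).meanEnergyObs 1)).re -
        μ * ((ω.expect {0} (nAt 0 (Finset.mem_singleton_self 0) 0)).re +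
          (ω.expect {0} (nAt 0 (Finset.mem_singleton_self 0) 1)).re) -
        h' * (2 * (ω.expect (pairRegion (insert (0 : Site 2) unitSteps) 0)
          (localPairAt (insert 0 unitSteps) dWaveFormFactor 0)).re) := by
    rw [InfVolFermionState.meanEnergy_hubbardTTPrimeSourced, ← InfVolFermionState.meanEnergy_pairSourceInteraction_dWave_eq,
      InfVolFermionState.meanEnergy, InfVolFermionState.density, InfVolFermionState.densityAt, map_add, Complex.add_re]
  rw [htarget]
  have hlim := (hE.sub ((hN0.add hN1).const_mul μ)).sub ((hP.const_mul 2).const_mul h')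
  refine hlim.congr' ?_
  filter_upwards [hLs.eventually_ge_atTop 3] with j hj
  have hcomp : ∀ i, p (Ls j) i *
      ((QuantumLattice.expect (dWaveSourceTorusTT' (Ls j) tp U μ h') (ψ (Ls j) i)).re / (Ls j : ℝ) ^ 2) =
      p (Ls j) i * (torusAvgExpect (Ls j) (thicken ({0} : Finset (Site 2)) 1)
          ((hubbardTTPrimeFermionInteraction 1 tp U).meanEnergyObs 1) (ψ (Ls j) i)).re -
        μ * (p (Ls j) i * (torusAvgExpect (Ls j) ({0} : Finset (Site 2)) (nAt 0 (Finset.mem_singleton_self 0) 0)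
            (ψ (Ls j) i)).re +
          p (Ls j) i * (torusAvgExpect (Ls j) ({0} : Finset (Site 2)) (nAt 0 (Finset.mem_singleton_self 0) 1)
            (ψ (Ls j) i)).re) -
        h' * (2 * (p (Ls j) i * (torusAvgExpect (Ls j) (pairRegion (insert (0 : Site 2) unitSteps) 0)
          (localPairAt (insert 0 unitSteps) dWaveFormFactor 0) (ψ (Ls j) i)).re)) := by
    intro i
    rw [re_expect_dWaveSourceTorusTT'_div_sq_eq (Ls j) hj tp U μ h' (ψ (Ls j) i)]
    ring
  rw [Finset.sum_congr rfl fun i _ => hcomp i, Finset.sum_sub_distrib, Finset.sum_sub_distrib, ← Finset.mul_sum,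
    ← Finset.mul_sum, ← Finset.mul_sum, Finset.sum_add_distrib]

/-- **A weighted CAP row bounds the sourced mean energy of a mixture torus limit from above** (vanishing slack
allowed): if eventually `Σ_i p_{j,i} Re⟨ψ_{j,i}, A_{L_j}(h) ψ_{j,i}⟩/L_j² ≤ u + c/L_j`, then `e^{src}_h(ω) ≤ u`.
[cite: Ruelle1969, §3.4] -/
theorem InfVolFermionState.IsTorusLimitOfMixture.meanEnergy_sourced_le_of_eventually_le
    [hL0 : ∀ j, NeZero (Ls j)] (hω : ω.IsTorusLimitOfMixture m p ψ Ls) (hLs : Tendsto Ls atTop atTop)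
    (tp U μ h : ℝ) {u c : ℝ}
    (hu : ∀ᶠ j in atTop, ∑ i, p (Ls j) i *
        ((QuantumLattice.expect (dWaveSourceTorusTT' (Ls j) tp U μ h) (ψ (Ls j) i)).re / (Ls j : ℝ) ^ 2) ≤
      u + c / (Ls j : ℝ)) :
    ω.meanEnergy (hubbardTTPrimeSourcedInteraction 1 tp U μ dWaveFormFactor h) 1 ≤ u :=
  le_of_tendsto_of_tendsto (hω.tendsto_sum_mul_re_expect_dWaveSourceTorusTT' hLs tp U μ h)
    (tendsto_const_add_div_natCast hLs u c) hu

/-- **A cap that is affine-plus-convex-quadratic in the number per site passes to the limit** (the shape of a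
Hartree term `U'·n²/4`): if eventually
`Σ_i p Re⟨A_L(h)⟩/L² ≤ C + μ'·n_L + U'·n_L²/4 + c/L` with `n_L = Σ_i p Re⟨N⟩/L²` the weighted number per site,
then `e^{src}_h(ω) ≤ C + μ'·ω.density + U'·ω.density²/4`. [cite: Ruelle1969, §3.4] [cite: BachLiebSolovej1994, §2] -/
theorem InfVolFermionState.IsTorusLimitOfMixture.meanEnergy_sourced_le_quad_density_of_eventually
    [hL0 : ∀ j, NeZero (Ls j)] (hω : ω.IsTorusLimitOfMixture m p ψ Ls) (hLs : Tendsto Ls atTop atTop)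
    (tp U μ h : ℝ) {C μ' U' c : ℝ}
    (hu : ∀ᶠ j in atTop, ∑ i, p (Ls j) i *
        ((QuantumLattice.expect (dWaveSourceTorusTT' (Ls j) tp U μ h) (ψ (Ls j) i)).re / (Ls j : ℝ) ^ 2) ≤
      C + μ' * (∑ i, p (Ls j) i * ((QuantumLattice.expect totalNumber (ψ (Ls j) i)).re / (Ls j : ℝ) ^ 2)) +
        U' * (∑ i, p (Ls j) i * ((QuantumLattice.expect totalNumber (ψ (Ls j) i)).re / (Ls j : ℝ) ^ 2)) ^ 2 / 4 +
        c / (Ls j : ℝ)) :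
    ω.meanEnergy (hubbardTTPrimeSourcedInteraction 1 tp U μ dWaveFormFactor h) 1 ≤
      C + μ' * ω.density + U' * ω.density ^ 2 / 4 := by
  have hn := hω.tendsto_sum_mul_re_expect_totalNumber (d := 2)
  have h0 : Tendsto (fun j => c / (Ls j : ℝ)) atTop (𝓝 0) :=
    tendsto_const_nhds.div_atTop (tendsto_natCast_atTop_atTop.comp hLs)
  have hR : Tendsto (fun j => C + μ' * (∑ i, p (Ls j) i *
      ((QuantumLattice.expect totalNumber (ψ (Ls j) i)).re / (Ls j : ℝ) ^ 2)) +
        U' * (∑ i, p (Ls j) i * ((QuantumLattice.expect totalNumber (ψ (Ls j) i)).re / (Ls j : ℝ) ^ 2)) ^ 2 / 4 +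
        c / (Ls j : ℝ)) atTop (𝓝 (C + μ' * ω.density + U' * ω.density ^ 2 / 4 + 0)) :=
    ((tendsto_const_nhds.add (hn.const_mul μ')).add (((hn.pow 2).const_mul U').div_const 4)).add h0
  rw [add_zero] at hR
  exact le_of_tendsto_of_tendsto (hω.tendsto_sum_mul_re_expect_dWaveSourceTorusTT' hLs tp U μ h) hR hu

end SourcedEnergy

end Literature.MathematicalPhysics.QuantumLattice

end
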